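/-
Copyright (c) 2026 the pub-hodgecm-mathlib formalisation cell (harness21).  Prover seat hodgecm-mathlib-K2E3-p03 (g10) on the S4 valve (dealer K2E2-plan (g8), S4-R38 (C),
CARD B = road (J̃♭) FILE (TJ2), part 2 of 2): THE ε-TWISTED TUBE IN THE CAYLEY CHART — ★ C8b-core `F0P3cStCharTSTwistedTubeCore` §2–§4 with an additive THIRD SLOT.
Crux H413 `stmt-HodgeConjecture-24833`, lane `--supports … --as helper` (count-neutral).  THEOREMS ONLY (no `def`, no `instance`, no notation, no named-fact hypothesis, no `sorry`).
-/
import Summits.HodgeConjecture.HodgeConjecture.Theorems.F0P3cStCharTSTwistedTubeCore   -- ★ C8b-core: §1 sub-box kit `subBox_le`, `le_subBox`, `subBox_antitone`, `isOpen_subBox`, `isCompact_subBox`, `subBox_basis`, `valBound_of_mem_level` (+ ★ C4, ★ C5, ★ C8a)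
import Summits.HodgeConjecture.HodgeConjecture.Theorems.R90S4CayleyTwistedThirdSlot      -- (TJ2) part 1: `cayley_twisted_triple_slot`, `valBound_twistedSandwich_slot`, `valBound_twisted_incr_of_sandwich_slot`
import HarnessLib

/-!
# R90-TF · S4 (Ch. 13.1–2) · road (J̃♭) «TWISTED TUBE JACOBIAN», FILE (TJ2): THE ε-TWISTED TUBE IN THE CAYLEY CHART — the filtered Newton hypothesis `(N_L)` for the
# twisted tube map `Θ_E`, the pointwise identity `c(X)·t₀·c(Y)·ε(c(X))⁻¹ = t₀·c(Θ_E(X ⊕ Y))`, and the tube measure `κ·ν(t₀ • c(Θ_E A)) = χ(L_E)·μ(A)`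

Dealt by the S4 dealer K2E2-plan (g8) (S4-R38 (C), 2026-09-05T02:21Z; road + letter = R90-C131-p04 (g2) HANDOFF ea14968918578db2 §«open hand», census `CENSUS-Jtilde.md` §2–§3).
THE ε-TWIN OF ★ C8b-core.  In the twisted Weyl integration formula [Rogawski1990, §12.5 p. 186] the tube is `(x, b) ↦ x·b·ε(x)⁻¹`; in the Cayley chart at `t₀` its last
factor is `ε(c(X))⁻¹ = c(τ X)` (★ (TJ1) p864452 `tau_cayley_inv`), so ★ C8b-core's third Cayley slot `−ι(pM Z)` becomes `E (ι (pM Z))` for an ADDITIVE, level-preserving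
`E : M_m(K) →+ M_m(K)` (= `τ` at the datum) and the linear part is **`L_E Z` with `ι (L_E Z) = T⁻¹ ι(pM Z) T + E (ι (pM Z)) + ι(pT Z)`** (census §2: `Ad(b₀⁻¹) pM + τ pM + pT`).
SETTING = ★ C8b-core's abstract frame VERBATIM (★ C4's `ι Λ ρ c`, complementary projections `pM pT`, sub-box `Λ′`, depth `k` with the two uniform shifts) plus the two
new data `(E, hE)` and, for §3, an abstract twist `ε : G → G` read in the chart by `hε : ρ(ε(c X))⁻¹ = cayley (E (ι X))` on `Λ 0` (at the datum: ★ `tau_cayley_inv` and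
`cayley(−W)·cayley(W) = 1`).  ★ C8b-core is the case `E = −id`, `ε = id`; its §1 sub-box kit is used BY IMPORT.
THE RESULTS (all PROVED; proofs = ★ C8b-core's with ★ C5 ↦ (TJ2) part 1).
* §2 **`twisted_newton_slot`** — `(N_{L_E})`: `Θ (x + y) − Θ x − L y ∈ L '' Λ′ (j + 1)` for `x ∈ Λ′ k`, `y ∈ Λ′ j`, `j ≥ k`; `twisted_mem_level_slot`; `symm_twisted_zero_mem_slot`.
* §3 **`tube_eq_mul_chart_twisted_slot`** — `c (pM Z) * t₀ * c (pT Z) * (ε (c (pM Z)))⁻¹ = t₀ * c (Θ Z)` for `Z ∈ Λ′ k`.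
* §4 **`tube_measure_eq_twisted_slot`** — `κ · ν (t₀ • c '' (Θ '' A)) = addEquivAddHaarChar L · μ A` for `A ⊆ Λ′ k` (★ C8a `tube_measure_eq` fed with §2).
NEXT ON THE ROAD: (TJ4) `R90S4TwistedTubeWindows` (coset windows, `b₀` bounded mod centre; weight ★ (TJ3) p864488), (TJ5) the (J̃♭) letter.
[HarishChandra1970, Lemma 22], [Serre1992LALG, Part II Ch. IV §8–§9], [Rogawski1990, §12.5], [Labesse1999, §III.1].
HONEST LABEL: HC_CM is proved only modulo the 7 printed citations (2 remaining named inputs: hLiu418 = `stmt-HodgeConjecture-24832`, h413 = `stmt-HodgeConjecture-24833`)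
until rung 0 closes; this file closes no organ ((J̃♭) stays OPEN until (TJ4)–(TJ5)); count-neutral.

## References
* [HarishChandra1970] Harish-Chandra (notes by G. van Dijk), *Harmonic Analysis on Reductive p-adic Groups*, LNM 162 (1970), Lemma 22.
* [Serre1992LALG] J.-P. Serre, *Lie Algebras and Lie Groups*, LNM 1500 (1992), Part II Ch. IV §8–§9.
* [Rogawski1990] J. Rogawski, *Automorphic Representations of Unitary Groups in Three Variables*, Ann. of Math. Stud. 123 (1990), §12.5 p. 186.
* [Labesse1999] J.-P. Labesse, *Cohomologie, stabilisation et changement de base*, Astérisque 257 (1999), §III.1.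
-/

set_option autoImplicit false
set_option linter.dupNamespace false

open Set Filter MeasureTheory MeasureTheory.Measure TopologicalSpace Topology Matrix ValuativeRel
open Literature.NumberTheory.Automorphic Literature.NumberTheory.Weil1982.UnitaryFinTopForm
open Summit.HodgeConjecture.HodgeConjecture.Cruxes.H413.F0P3cStCharTSCayleyChartHaar
open Summit.HodgeConjecture.HodgeConjecture.Cruxes.H413.F0P3cStCharTSTubeMeasureChart
open Summit.HodgeConjecture.HodgeConjecture.Cruxes.H413.F0P3cStCharTSTwistedTubeCore
open scoped Pointwise Topology ENNReal MatrixGroups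

namespace Summit.HodgeConjecture.HodgeConjecture.R90.S4

/-! ## §2 The filtered Newton hypothesis `(N_L)` for the ε-twisted tube map -/

section Newton

variable {K : Type*} [Field K] [ValuativeRel K] {m : Type*} [Fintype m] [DecidableEq m]
  {V : Type*} [AddCommGroup V] [TopologicalSpace V]
  (ι : V →+ Matrix m m K) (Λ : ℕ → AddSubgroup V) {α : ValueGroupWithZero K} (pM pT : V →+ V) {Λ' : ℕ → AddSubgroup V}
  (L : V ≃ₜ+ V) (Θ : V → V) (E : Matrix m m K →+ Matrix m m K) {T Tinv : Matrix m m K} {k : ℕ}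

/-- **`(N_L)` FOR THE ε-TWISTED TUBE MAP**: `Θ (x + y) − Θ x − L y ∈ L '' Λ′ (j + 1)` for `x ∈ Λ′ k`, `y ∈ Λ′ j`, `j ≥ k`, with the linear part
`ι (L Z) = T⁻¹ ι(pM Z) T + E (ι (pM Z)) + ι(pT Z)`, provided `E` preserves the entrywise bounds (`hE`) and the base depth `k` absorbs the uniform shift of `pM ∘ L⁻¹`,
`pT ∘ L⁻¹` (`hshiftL`). [cite: HarishChandra1970, Lemma 22] [cite: Serre1992LALG, Part II Ch. IV §8] [cite: Rogawski1990, §12.5] -/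
theorem twisted_newton_slot (hΛ : ∀ j X, X ∈ Λ j ↔ ValBound (α ^ (j + 1)) (ι X)) (hα1 : α < 1)
    (hΛ' : ∀ j Z, Z ∈ Λ' j ↔ (pM Z ∈ Λ j ∧ pT Z ∈ Λ j))
    (hT1 : ValBound 1 T) (hTinv1 : ValBound 1 Tinv) (hE : ∀ (γ : ValueGroupWithZero K) (W : Matrix m m K), ValBound γ W → ValBound γ (E W))
    (hL : ∀ Z, ι (L Z) = Tinv * ι (pM Z) * T + E (ι (pM Z)) + ι (pT Z))
    (hΘ : ∀ Z ∈ Λ' k, ι (Θ Z) =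
      (fun W X : Matrix m m K => (1 - W)⁻¹ * (W + X) * (1 + W * X)⁻¹ * (1 - W)) (Tinv * ι (pM Z) * T)
        ((fun W X : Matrix m m K => (1 - W)⁻¹ * (W + X) * (1 + W * X)⁻¹ * (1 - W)) (ι (pT Z)) (E (ι (pM Z)))))
    (hshiftL : ∀ j, ∀ Z ∈ Λ (j + k), pM (L.symm Z) ∈ Λ j ∧ pT (L.symm Z) ∈ Λ j) :
    ∀ j, k ≤ j → ∀ x ∈ Λ' k, ∀ y ∈ Λ' j, Θ (x + y) - Θ x - L y ∈ L '' (Λ' (j + 1) : Set V) := by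
  intro j hj x hx y hy
  have hanti' : Antitone Λ' := subBox_antitone hΛ' (level_antitone ι Λ hΛ hα1.le)
  have hxy : x + y ∈ Λ' k := add_mem hx (hanti' hj hy)
  obtain ⟨hxM, hxT⟩ := (hΛ' k x).1 hx
  obtain ⟨hyM, hyT⟩ := (hΛ' j y).1 hy
  -- the bounds: `ρ = α^(k+1)`, `γ = α^(j+1)`
  have hρ : α ^ (k + 1) < 1 := pow_lt_one₀ zero_le hα1 (Nat.succ_ne_zero k)
  have hγ : α ^ (j + 1) ≤ α ^ (k + 1) := pow_le_pow_right_of_le_one' hα1.le (by omega)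
  -- (TJ2) part 1 through `ι`
  have key := valBound_twisted_incr_of_sandwich_slot (fun W X : Matrix m m K => (1 - W)⁻¹ * (W + X) * (1 + W * X)⁻¹ * (1 - W)) hρ hγ
    (fun hW hX => by simpa only [max_self] using valBound_cayleySandwich hW hX hρ hρ)
    (fun hW hX hD hE' hδ hε => valBound_cayleySandwich_incr_both hW hX hD hE' hρ hδ hε) E hT1 hTinv1
    (valBound_of_mem_level ι Λ hΛ hxM) (valBound_of_mem_level ι Λ hΛ hxT) (valBound_of_mem_level ι Λ hΛ hyM) (valBound_of_mem_level ι Λ hΛ hyT)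
    (hE _ _ (valBound_of_mem_level ι Λ hΛ hxM)) (hE _ _ (valBound_of_mem_level ι Λ hΛ hyM))
  -- the same element, read in `V`
  have hιE : ι (Θ (x + y) - Θ x - L y)
      = (fun W X : Matrix m m K => (1 - W)⁻¹ * (W + X) * (1 + W * X)⁻¹ * (1 - W)) (Tinv * (ι (pM x) + ι (pM y)) * T)
        ((fun W X : Matrix m m K => (1 - W)⁻¹ * (W + X) * (1 + W * X)⁻¹ * (1 - W)) (ι (pT x) + ι (pT y)) (E (ι (pM x) + ι (pM y))))
      - (fun W X : Matrix m m K => (1 - W)⁻¹ * (W + X) * (1 + W * X)⁻¹ * (1 - W)) (Tinv * ι (pM x) * T)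
        ((fun W X : Matrix m m K => (1 - W)⁻¹ * (W + X) * (1 + W * X)⁻¹ * (1 - W)) (ι (pT x)) (E (ι (pM x))))
      - (Tinv * ι (pM y) * T + E (ι (pM y)) + ι (pT y)) := by
    rw [map_sub, map_sub, hΘ _ hxy, hΘ _ hx, hL y, map_add, map_add, map_add, map_add]
  have hEmem : Θ (x + y) - Θ x - L y ∈ Λ (j + 1 + k) := by
    refine (hΛ _ _).2 ?_
    rw [hιE, show j + 1 + k + 1 = (k + 1) + (j + 1) by omega, pow_add]
    exact key
  obtain ⟨h1, h2⟩ := hshiftL (j + 1) _ hEmem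
  exact ⟨L.symm (Θ (x + y) - Θ x - L y), (hΛ' _ _).2 ⟨h1, h2⟩, L.apply_symm_apply _⟩

omit [TopologicalSpace V] in
/-- The ε-twisted tube map lands in the level `Λ k` ((TJ2) part 1 `valBound_twistedSandwich_slot`). [cite: Serre1992LALG, Part II Ch. IV §8] -/
theorem twisted_mem_level_slot (hΛ : ∀ j X, X ∈ Λ j ↔ ValBound (α ^ (j + 1)) (ι X)) (hα1 : α < 1)
    (hΛ' : ∀ j Z, Z ∈ Λ' j ↔ (pM Z ∈ Λ j ∧ pT Z ∈ Λ j)) (hT1 : ValBound 1 T) (hTinv1 : ValBound 1 Tinv)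
    (hE : ∀ (γ : ValueGroupWithZero K) (W : Matrix m m K), ValBound γ W → ValBound γ (E W))
    (hΘ : ∀ Z ∈ Λ' k, ι (Θ Z) =
      (fun W X : Matrix m m K => (1 - W)⁻¹ * (W + X) * (1 + W * X)⁻¹ * (1 - W)) (Tinv * ι (pM Z) * T)
        ((fun W X : Matrix m m K => (1 - W)⁻¹ * (W + X) * (1 + W * X)⁻¹ * (1 - W)) (ι (pT Z)) (E (ι (pM Z))))) :
    ∀ Z ∈ Λ' k, Θ Z ∈ Λ k := by
  intro Z hZ
  obtain ⟨hM, hT⟩ := (hΛ' k Z).1 hZ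
  have hρ : α ^ (k + 1) < 1 := pow_lt_one₀ zero_le hα1 (Nat.succ_ne_zero k)
  rw [hΛ, hΘ Z hZ]
  exact valBound_twistedSandwich_slot hT1 hTinv1 (valBound_of_mem_level ι Λ hΛ hM) (valBound_of_mem_level ι Λ hΛ hT)
    (hE _ _ (valBound_of_mem_level ι Λ hΛ hM)) hρ

omit [ValuativeRel K] in
/-- `Θ 0 = 0` (the third slot is additive, (TJ2) part 1 `twistedSandwich_slot_zero`), hence `L⁻¹ (Θ 0) ∈ Λ′ k`. [cite: Serre1992LALG, Part II Ch. IV §8] -/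
theorem symm_twisted_zero_mem_slot (hinj : Function.Injective ι)
    (hΘ : ∀ Z ∈ Λ' k, ι (Θ Z) =
      (fun W X : Matrix m m K => (1 - W)⁻¹ * (W + X) * (1 + W * X)⁻¹ * (1 - W)) (Tinv * ι (pM Z) * T)
        ((fun W X : Matrix m m K => (1 - W)⁻¹ * (W + X) * (1 + W * X)⁻¹ * (1 - W)) (ι (pT Z)) (E (ι (pM Z))))) :
    Θ 0 = 0 ∧ L.symm (Θ 0) ∈ Λ' k := by
  have h0 : Θ 0 = 0 := by
    apply hinj
    rw [hΘ 0 (zero_mem _), map_zero, map_zero, map_zero]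
    simp [map_zero]
  refine ⟨h0, ?_⟩
  rw [h0, map_zero]
  exact zero_mem _

end Newton

/-! ## §3 The pointwise ε-twisted tube identity in `G` -/

section Tube

variable {K : Type*} [Field K] [ValuativeRel K] {m : Type*} [Fintype m] [DecidableEq m]
  {V : Type*} [AddCommGroup V] {G : Type*} [Group G]
  (ι : V →+ Matrix m m K) (Λ : ℕ → AddSubgroup V) {α : ValueGroupWithZero K} (ρ : G →* GL m K) (c : V → G)
  (pM pT : V →+ V) {Λ' : ℕ → AddSubgroup V} (Θ : V → V) (E : Matrix m m K →+ Matrix m m K) (ε : G → G) (t₀ : G) {k : ℕ}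

/-- **THE ε-TWISTED TUBE IDENTITY**: `c (pM Z) · t₀ · c (pT Z) · ε(c (pM Z))⁻¹ = t₀ · c (Θ Z)` for `Z ∈ Λ′ k`, where the twist is read in the chart by
`ρ(ε(c X))⁻¹ = cayley (E (ι X))` on `Λ 0` (at the datum: ★ (TJ1) `tau_cayley_inv`, `E = τ`) — (TJ2) part 1 `cayley_twisted_triple_slot`; `ρ` injective; `T = ρ t₀` integral with
integral inverse. [cite: Rogawski1990, §12.5] [cite: HarishChandra1970, Lemma 22] [cite: PlatonovRapinchuk1994, §3.3] -/
theorem tube_eq_mul_chart_twisted_slot (hΛ : ∀ j X, X ∈ Λ j ↔ ValBound (α ^ (j + 1)) (ι X)) (hα1 : α < 1) (hρinj : Function.Injective ρ)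
    (hc : ∀ X ∈ Λ 0, ((ρ (c X) : GL m K) : Matrix m m K) = cayley (ι X))
    (hΛ' : ∀ j Z, Z ∈ Λ' j ↔ (pM Z ∈ Λ j ∧ pT Z ∈ Λ j))
    (hT1 : ValBound 1 ((ρ t₀ : GL m K) : Matrix m m K)) (hTinv1 : ValBound 1 (((ρ t₀)⁻¹ : GL m K) : Matrix m m K))
    (hE : ∀ (γ : ValueGroupWithZero K) (W : Matrix m m K), ValBound γ W → ValBound γ (E W))
    (hε : ∀ X ∈ Λ 0, (((ρ (ε (c X)))⁻¹ : GL m K) : Matrix m m K) = cayley (E (ι X)))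
    (hΘ : ∀ Z ∈ Λ' k, ι (Θ Z) =
      (fun W X : Matrix m m K => (1 - W)⁻¹ * (W + X) * (1 + W * X)⁻¹ * (1 - W)) ((((ρ t₀)⁻¹ : GL m K) : Matrix m m K) * ι (pM Z) * ((ρ t₀ : GL m K) : Matrix m m K))
        ((fun W X : Matrix m m K => (1 - W)⁻¹ * (W + X) * (1 + W * X)⁻¹ * (1 - W)) (ι (pT Z)) (E (ι (pM Z)))))
    {Z : V} (hZ : Z ∈ Λ' k) :
    c (pM Z) * t₀ * c (pT Z) * (ε (c (pM Z)))⁻¹ = t₀ * c (Θ Z) := by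
  have hanti := level_antitone ι Λ hΛ hα1.le
  obtain ⟨hM, hT⟩ := (hΛ' k Z).1 hZ
  have hM0 : pM Z ∈ Λ 0 := hanti (Nat.zero_le k) hM
  have hT0 : pT Z ∈ Λ 0 := hanti (Nat.zero_le k) hT
  have hΘ0 : Θ Z ∈ Λ 0 := hanti (Nat.zero_le k)
    (twisted_mem_level_slot ι Λ pM pT Θ E hΛ hα1 hΛ' hT1 hTinv1 hE hΘ Z hZ)
  have hρ' : α ^ (k + 1) < 1 := pow_lt_one₀ zero_le hα1 (Nat.succ_ne_zero k)
  -- read everything in `GL m K`, then in matrices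
  apply hρinj
  apply Units.ext
  simp only [map_mul, map_inv, Units.val_mul]
  rw [hε _ hM0, hc _ hM0, hc _ hT0, hc _ hΘ0, hΘ Z hZ]
  have hTT : ((ρ t₀ : GL m K) : Matrix m m K) * (((ρ t₀)⁻¹ : GL m K) : Matrix m m K) = 1 := by
    rw [← Units.val_mul, mul_inv_cancel, Units.val_one]
  have hTT' : (((ρ t₀)⁻¹ : GL m K) : Matrix m m K) * ((ρ t₀ : GL m K) : Matrix m m K) = 1 := by
    rw [← Units.val_mul, inv_mul_cancel, Units.val_one]
  have key := cayley_twisted_triple_slot hTT hTT' hT1 hTinv1 (valBound_of_mem_level ι Λ hΛ hM) (valBound_of_mem_level ι Λ hΛ hT)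
    (hE _ _ (valBound_of_mem_level ι Λ hΛ hM)) hρ'
  -- `c(X) T c(Y) c(E X) = T · (T⁻¹ c(X) T c(Y) c(E X))`
  calc cayley (ι (pM Z)) * ((ρ t₀ : GL m K) : Matrix m m K) * cayley (ι (pT Z)) * cayley (E (ι (pM Z)))
      = ((ρ t₀ : GL m K) : Matrix m m K) * ((((ρ t₀)⁻¹ : GL m K) : Matrix m m K) * cayley (ι (pM Z)) * ((ρ t₀ : GL m K) : Matrix m m K)
          * cayley (ι (pT Z)) * cayley (E (ι (pM Z)))) := by
        rw [show ((ρ t₀ : GL m K) : Matrix m m K) * ((((ρ t₀)⁻¹ : GL m K) : Matrix m m K) * cayley (ι (pM Z)) * ((ρ t₀ : GL m K) : Matrix m m K)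
            * cayley (ι (pT Z)) * cayley (E (ι (pM Z))))
            = (((ρ t₀ : GL m K) : Matrix m m K) * (((ρ t₀)⁻¹ : GL m K) : Matrix m m K)) * cayley (ι (pM Z)) * ((ρ t₀ : GL m K) : Matrix m m K)
              * cayley (ι (pT Z)) * cayley (E (ι (pM Z))) by simp only [Matrix.mul_assoc], hTT, Matrix.one_mul]
    _ = ((ρ t₀ : GL m K) : Matrix m m K) * cayley _ := by rw [key]

end Tube

/-! ## §4 The ε-twisted tube measure -/

section TubeMeasure

variable {K : Type*} [Field K] [ValuativeRel K] [TopologicalSpace K] [IsNonarchimedeanLocalField K]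
  {m : Type*} [Fintype m] [DecidableEq m]
  {V : Type*} [AddCommGroup V] [TopologicalSpace V] [IsTopologicalAddGroup V] [T2Space V] [SecondCountableTopology V]
  [LocallyCompactSpace V] [MeasurableSpace V] [BorelSpace V]
  {G : Type*} [Group G] [MeasurableSpace G]
  (ι : V →+ Matrix m m K) (Λ : ℕ → AddSubgroup V) {α : ValueGroupWithZero K} (c : V → G)
  (pM pT : V →+ V) {Λ' : ℕ → AddSubgroup V} (L : V ≃ₜ+ V) (Θ : V → V) (E : Matrix m m K →+ Matrix m m K) {T Tinv : Matrix m m K} {k : ℕ}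
  (μ : Measure V) [μ.IsAddHaarMeasure] (ν : Measure G) [ν.IsMulLeftInvariant]

/-- **THE ε-TWISTED TUBE MEASURE**: `κ · ν (t₀ • c '' (Θ '' A)) = addEquivAddHaarChar L · μ A` for `A ⊆ Λ′ k` with Borel images, where `κ · ν (c '' B) = μ B` on `Λ 0`
(★ C4∕C4u) and `L = L_E` is the twisted linear part — ★ C8a `tube_measure_eq` fed with §2; at the datum `addEquivAddHaarChar L_E = cartanWeight (N b₀)` by ★ (TJ3) p864488.
[cite: HarishChandra1970, Lemma 22] [cite: Rogawski1990, §12.5] [cite: Labesse1999, §III.1] -/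
theorem tube_measure_eq_twisted_slot (hι : IsClosedEmbedding ι) (hΛ : ∀ j X, X ∈ Λ j ↔ ValBound (α ^ (j + 1)) (ι X)) (hα : α ≠ 0) (hα1 : α < 1)
    (hΛ' : ∀ j Z, Z ∈ Λ' j ↔ (pM Z ∈ Λ j ∧ pT Z ∈ Λ j)) (hsum : ∀ Z, pM Z + pT Z = Z)
    (hshift : ∀ j, ∀ Z ∈ Λ (j + k), pM Z ∈ Λ j ∧ pT Z ∈ Λ j)
    (hT1 : ValBound 1 T) (hTinv1 : ValBound 1 Tinv) (hE : ∀ (γ : ValueGroupWithZero K) (W : Matrix m m K), ValBound γ W → ValBound γ (E W))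
    (hL : ∀ Z, ι (L Z) = Tinv * ι (pM Z) * T + E (ι (pM Z)) + ι (pT Z))
    (hΘ : ∀ Z ∈ Λ' k, ι (Θ Z) =
      (fun W X : Matrix m m K => (1 - W)⁻¹ * (W + X) * (1 + W * X)⁻¹ * (1 - W)) (Tinv * ι (pM Z) * T)
        ((fun W X : Matrix m m K => (1 - W)⁻¹ * (W + X) * (1 + W * X)⁻¹ * (1 - W)) (ι (pT Z)) (E (ι (pM Z)))))
    (hΘc : ContinuousOn Θ (Λ' k : Set V))
    (hshiftL : ∀ j, ∀ Z ∈ Λ (j + k), pM (L.symm Z) ∈ Λ j ∧ pT (L.symm Z) ∈ Λ j)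
    {κ : ℝ≥0∞} (hchart : ∀ B ⊆ (Λ 0 : Set V), MeasurableSet (c '' B) → κ * ν (c '' B) = μ B)
    (t₀ : G) {A : Set V} (hA : A ⊆ (Λ' k : Set V)) (hAm : MeasurableSet (Θ '' A)) (hAcm : MeasurableSet (c '' (Θ '' A))) :
    κ * ν (t₀ • (c '' (Θ '' A))) = addEquivAddHaarChar L * μ A := by
  have hanti := level_antitone ι Λ hΛ hα1.le
  have hopenΛ := isOpen_level ι Λ hι.continuous hΛ hα
  have hcompΛ := isCompact_level ι Λ hι hΛ
  refine tube_measure_eq Λ' Θ L μ c ν (subBox_antitone hΛ' hanti) (isOpen_subBox hΛ' hopenΛ hshift)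
    (isCompact_subBox hΛ' hopenΛ hcompΛ hshift hsum k)
    (subBox_basis hΛ' hsum (exists_level_subset_of_mem_nhds ι Λ hι hΛ hα1)) hΘc
    (twisted_newton_slot ι Λ pM pT L Θ E hΛ hα1 hΛ' hT1 hTinv1 hE hL hΘ hshiftL)
    (symm_twisted_zero_mem_slot ι pM pT L Θ E hι.injective hΘ).2 (S := (Λ 0 : Set V)) ?_ hchart t₀ hA hAm hAcm
  rintro _ ⟨Z, hZ, rfl⟩
  exact hanti (Nat.zero_le k) (twisted_mem_level_slot ι Λ pM pT Θ E hΛ hα1 hΛ' hT1 hTinv1 hE hΘ Z hZ)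

end TubeMeasure

end Summit.HodgeConjecture.HodgeConjecture.R90.S4
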